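import Summits.QuantumFields.BalabanUV.T4Continuum.Spine.BackgroundResolventLaw

/-!
# T⁴ programme, spine node NE2 (U1a) — THE BACKGROUND RESOLVENT TOWER: `OneStepAveragedLaw` and `TowerLimitRate` for the
# PERTURBED propagators `(D_k + tP_k)⁻¹` from the `U = 1` tower laws and two typed inequalities on the perturbation

Ninth generation of the NE2 prover lineage P1 of the cell `pub-balaban`, file 2 (companion of `Spine/BackgroundResolventLaw`).
That file proved, for two levels, the PERTURBED SANDWICHED LAW `‖Ã(D′ + tP′)⁻¹Ãᴴ − (D + tP)⁻¹‖ ≤ (e₁ + ‖t‖e₂)ν² + (e₀ + 2f)ν`.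
Here the level families are assembled:

 * §1 TWO NAMED HYPOTHESIS BUNDLES over level families `D_k` (free operators), `A_k` (one-step averagings, `‖A_k‖² ≤ r⁻¹`),
   `J_k` (one-step injections, `‖J_k‖ ≤ 1`), `F_k` (pairing defects, `√r·A_kJ_k = 1 + F_k`):
   **`FreeTowerLaws D A J F r e₀ e₁ f`** — the UNPERTURBED (`U = 1`) inputs: invertibility, the injected defect
   `‖D_{k+1}⁻¹J_k − J_kD_k⁻¹‖ ≤ e₁ k`, the complement defect `‖D_{k+1}⁻¹(1 − J_kJ_kᴴ)‖ ≤ e₀ k`, the pairing defects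
   `‖F_kD_k⁻¹‖, ‖D_k⁻¹F_kᴴ‖ ≤ f k`.  AT `U = 1` THESE ARE THEOREMS for Bałaban's `Δ_a` (1.69)/(1.73) and King's pairing
   `J_k = L^{d/2}Q_Lᴴ` (`F = 0`) — instantiated in `Support/KingPairingPlantedLaw` (this generation) from the tree's
   `B5G183RateTorusW.opNorm_Qavg_calG_rate`, `BalabanBlockPoincare.opNorm_one_sub_Pi_mul_le` and (1.89);
   **`PerturbationLaws D P J κ e₂`** — THE TWO TYPED MISSING INEQUALITIES of NE2⁺ on the resolvent route: (H-bd) relative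
   boundedness `‖P_kD_k⁻¹‖, ‖D_k⁻¹P_k‖ ≤ κ` and (H-cons) two-level consistency `‖D_{k+1}⁻¹(P_{k+1}J_k − J_kP_k)D_k⁻¹‖ ≤ e₂ k`.
   NOT IN PRINT for Bałaban's `P(U) = Δ_a(U) − Δ_a` ([Balaban1985BackgroundPropagators] prints η-UNIFORM bounds only, cell GAPS
   G-t4-U1a-1); ASSERTED BY NOBODY here.
 * §2 **`oneStepAveragedLaw_perturbed`**: under both bundles and `‖t‖κ < 1`, the perturbed propagators
   `X_k(t) = (D_k + tP_k)⁻¹` satisfy `CovariantAveragingTower.OneStepAveragedLaw A r X(t) E(t)` with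
   `E(t) k = (e₁ k + ‖t‖·e₂ k)ν² + (e₀ k + 2f k)ν`, `ν = (1 − ‖t‖κ)⁻¹`; **`towerLimitRate_perturbed`**: geometric defects
   `≤ C_iρ^k`, `ρ < 1` ⟹ `TowerLimitRate A r X(t) C(t) ρ` with `C(t) = (C₁ + ‖t‖C₂)ν² + (C₀ + 2C_f)ν` — generation 8's typed
   `U ≠ 1` wall in its sandwiched shape, DISCHARGED for perturbed carriers MODULO `PerturbationLaws`.
 * §3 LIPSCHITZ IN THE COUPLING, uniformly along the tower and in the limit: `‖c_k(t) − c_k(0)‖ ≤ ‖t‖κ·γ⁻¹·ν` whenever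
   `‖D_k⁻¹‖ ≤ γ⁻¹` (**`opNorm_avgTow_perturbed_sub_le`**, **`opNorm_limit_perturbed_sub_le`**) — the operator-norm form of the
   cell's sub-estimate NE2-LIP (background-Lipschitz continuity at fixed and at vanishing lattice spacing).

HONEST FRAMING (T4-DAG p. 1).  [folklore]-level bookkeeping over finite matrices, statements OURS; no covariant carrier is
constructed — the background enters as an abstract perturbation family; no conditional of the cell used or hidden; finite torus
/ linear layer / operator norm when instantiated; NOT infinite volume, NOT a mass gap, NOT Clay, NOT summit progress; spine 0/9
unchanged.  HONEST DEPENDENCY: continuum YM on T⁴ ⇐ BetaPertH ∧ nine spine estimates (0/9 proved); BetaPertH ⇐ (D1) ∧ (D4) ∧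
CAP+tail; G-an2-4 gates asym, D1 and NE2/3/4.  ABSOLUTE RULE kept; no `sorry`.
-/

noncomputable section

open scoped BigOperators ComplexConjugate Matrix Matrix.Norms.L2Operator
open Filter Topology

namespace Summit.QuantumFields.BalabanUV.T4Continuum.BackgroundResolventTower

open Summit.QuantumFields.BalabanUV.T4Continuum
open Summit.QuantumFields.BalabanUV.T4Continuum.CovariantAveragingTower (Atow avgTow OneStepAveragedLaw TowerLimitRate
  towerLimitRate_of_oneStepAveragedLaw opNorm_Atow_sq_le)
open Summit.QuantumFields.BalabanUV.T4Continuum.BackgroundResolventLaw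

variable {ι : ℕ → Type*} [∀ k, Fintype (ι k)] [∀ k, DecidableEq (ι k)]

/-! ## §1 The two hypothesis bundles -/

/-- **THE `U = 1` TOWER INPUTS** for free operators `D_k`, one-step averagings `A_k` (normalisation `‖A_k‖² ≤ r⁻¹`), one-step
injections `J_k` and pairing defects `F_k` (`√r·A_kJ_k = 1 + F_k`), with defect sequences `e₀` (complement), `e₁` (injected),
`f` (pairing).  A hypothesis shape; at `U = 1` a THEOREM for Bałaban's `Δ_a` and King's pairing (`Support/KingPairingPlantedLaw`).
[folklore] -/
structure FreeTowerLaws (D : (k : ℕ) → Matrix (ι k) (ι k) ℂ) (A : (k : ℕ) → Matrix (ι k) (ι (k + 1)) ℂ)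
    (J : (k : ℕ) → Matrix (ι (k + 1)) (ι k) ℂ) (F : (k : ℕ) → Matrix (ι k) (ι k) ℂ) (r : ℝ) (e₀ e₁ f : ℕ → ℝ) : Prop where
  /-- every free operator is invertible -/
  isUnit_det : ∀ k, IsUnit (D k).det
  /-- the one-step averagings have `‖A_k‖² ≤ r⁻¹` -/
  opNorm_A_sq_le : ∀ k, ‖A k‖ ^ 2 ≤ r⁻¹
  /-- the one-step injections are contractions -/
  opNorm_J_le : ∀ k, ‖J k‖ ≤ 1
  /-- the pairing: averaging an injected field returns it up to `F_k` -/
  A_mul_J : ∀ k, (((Real.sqrt r : ℝ) : ℂ)) • (A k * J k) = 1 + F k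
  /-- pairing defect, right -/
  opNorm_F_mul_inv_le : ∀ k, ‖F k * (D k)⁻¹‖ ≤ f k
  /-- pairing defect, left -/
  opNorm_inv_mul_F_le : ∀ k, ‖(D k)⁻¹ * (F k)ᴴ‖ ≤ f k
  /-- complement defect: the finer free propagator is small off the injected functions -/
  complement_le : ∀ k, ‖(D (k + 1))⁻¹ * (1 - J k * (J k)ᴴ)‖ ≤ e₀ k
  /-- injected defect: the finer free propagator on injected functions is the injected coarser one -/
  injected_le : ∀ k, ‖(D (k + 1))⁻¹ * J k - J k * (D k)⁻¹‖ ≤ e₁ k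

/-- **THE TWO TYPED MISSING INEQUALITIES OF NE2⁺ (resolvent route)** for a perturbation family `P_k` of the free operators:
(H-bd) `‖P_kD_k⁻¹‖, ‖D_k⁻¹P_k‖ ≤ κ` at every level (relative boundedness — the size of the background), and (H-cons)
`‖D_{k+1}⁻¹(P_{k+1}J_k − J_kP_k)D_k⁻¹‖ ≤ e₂ k` (consistency of the perturbations at adjacent spacings, read through one free
propagator on each side — the cell's «canonical pairing» of backgrounds).  NOT IN PRINT; asserted by nobody. [folklore] -/
structure PerturbationLaws (D P : (k : ℕ) → Matrix (ι k) (ι k) ℂ) (J : (k : ℕ) → Matrix (ι (k + 1)) (ι k) ℂ) (κ : ℝ)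
    (e₂ : ℕ → ℝ) : Prop where
  /-- (H-bd), right -/
  opNorm_P_mul_inv_le : ∀ k, ‖P k * (D k)⁻¹‖ ≤ κ
  /-- (H-bd), left -/
  opNorm_inv_mul_P_le : ∀ k, ‖(D k)⁻¹ * P k‖ ≤ κ
  /-- (H-cons) -/
  consistent_le : ∀ k, ‖(D (k + 1))⁻¹ * (P (k + 1) * J k - J k * P k) * (D k)⁻¹‖ ≤ e₂ k

/-! ## §2 The perturbed one-step law and the tower limit with rate -/

section Tower

variable {D P : (k : ℕ) → Matrix (ι k) (ι k) ℂ} {A : (k : ℕ) → Matrix (ι k) (ι (k + 1)) ℂ}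
  {J : (k : ℕ) → Matrix (ι (k + 1)) (ι k) ℂ} {F : (k : ℕ) → Matrix (ι k) (ι k) ℂ} {r κ : ℝ} {e₀ e₁ e₂ f : ℕ → ℝ}


/-- `‖√r·A‖ ≤ 1` from `‖A‖² ≤ r⁻¹`. [folklore] -/
theorem opNorm_normalised_le {α β : Type*} [Fintype α] [DecidableEq α] [Fintype β] [DecidableEq β] (hr : 0 < r)
    {X : Matrix α β ℂ} (hX : ‖X‖ ^ 2 ≤ r⁻¹) : ‖(((Real.sqrt r : ℝ) : ℂ)) • X‖ ≤ 1 := by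
  rw [norm_smul, Complex.norm_real, Real.norm_of_nonneg (Real.sqrt_nonneg r)]
  have h1 : (Real.sqrt r * ‖X‖) ^ 2 ≤ 1 := by
    rw [mul_pow, Real.sq_sqrt hr.le]
    calc r * ‖X‖ ^ 2 ≤ r * r⁻¹ := mul_le_mul_of_nonneg_left hX hr.le
      _ = 1 := mul_inv_cancel₀ hr.ne'
  nlinarith [Real.sqrt_nonneg r, norm_nonneg X, mul_nonneg (Real.sqrt_nonneg r) (norm_nonneg X)]

/-- the error sequence of the perturbed one-step law at coupling `t`. [folklore] -/
def Epert (κ : ℝ) (e₀ e₁ e₂ f : ℕ → ℝ) (t : ℂ) (k : ℕ) : ℝ :=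
  (e₁ k + ‖t‖ * e₂ k) * ((1 - ‖t‖ * κ)⁻¹) ^ 2 + (e₀ k + 2 * f k) * (1 - ‖t‖ * κ)⁻¹

/-- **THE PERTURBED ONE-STEP AVERAGED LAW**: under `FreeTowerLaws` and `PerturbationLaws`, for every coupling with `‖t‖κ < 1`,
`OneStepAveragedLaw A r (k ↦ (D_k + tP_k)⁻¹) (Epert κ e₀ e₁ e₂ f t)`.  Generation 8's typed `U ≠ 1` wall, sandwiched shape,
DISCHARGED for perturbed carriers modulo `PerturbationLaws`. [folklore] -/
theorem oneStepAveragedLaw_perturbed (hr : 0 < r) (hfree : FreeTowerLaws D A J F r e₀ e₁ f)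
    (hpert : PerturbationLaws D P J κ e₂) {t : ℂ} (ht : ‖t‖ * κ < 1) :
    OneStepAveragedLaw A r (fun k => (D k + t • P k)⁻¹) (Epert κ e₀ e₁ e₂ f t) := by
  intro k
  have hs0 : 0 < Real.sqrt r := Real.sqrt_pos.mpr hr
  have hsC : (((Real.sqrt r : ℝ) : ℂ)) ≠ 0 := by exact_mod_cast hs0.ne'
  set At : Matrix (ι k) (ι (k + 1)) ℂ := (((Real.sqrt r : ℝ) : ℂ)) • A k with hAt_def
  have hAt : ‖At‖ ≤ 1 := opNorm_normalised_le hr (hfree.opNorm_A_sq_le k)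
  have hAJ : At * J k = 1 + F k := by rw [hAt_def, Matrix.smul_mul]; exact hfree.A_mul_J k
  have key := perturbed_sandwich_law (J := J k) (hfree.isUnit_det k) (hfree.isUnit_det (k + 1))
    (hpert.opNorm_P_mul_inv_le k) (hpert.opNorm_inv_mul_P_le k) (hpert.opNorm_inv_mul_P_le (k + 1)) ht hAt
    (hfree.opNorm_J_le k) hAJ (hfree.opNorm_F_mul_inv_le k) (hfree.opNorm_inv_mul_F_le k) (hfree.complement_le k)
    (hfree.injected_le k) (hpert.consistent_le k)
  -- `A X′ Aᴴ − r⁻¹X = r⁻¹·(Ã X′ Ãᴴ − X)`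
  have hss : star ((((Real.sqrt r : ℝ) : ℂ))) = (((Real.sqrt r : ℝ) : ℂ)) := Complex.conj_ofReal _
  have hsq : ((((Real.sqrt r : ℝ) : ℂ))) * (((Real.sqrt r : ℝ) : ℂ)) = (r : ℂ) := by
    rw [← Complex.ofReal_mul, Real.mul_self_sqrt hr.le]
  have hrC : (r : ℂ) ≠ 0 := by exact_mod_cast hr.ne'
  have e : A k * (D (k + 1) + t • P (k + 1))⁻¹ * (A k)ᴴ - ((r : ℂ))⁻¹ • (D k + t • P k)⁻¹
      = ((r : ℂ))⁻¹ • (At * (D (k + 1) + t • P (k + 1))⁻¹ * Atᴴ - (D k + t • P k)⁻¹) := by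
    rw [hAt_def, Matrix.conjTranspose_smul, hss, Matrix.smul_mul, Matrix.smul_mul, Matrix.mul_smul, smul_smul, hsq,
      smul_sub, smul_smul, inv_mul_cancel₀ hrC, one_smul]
  rw [e, norm_smul, norm_inv, Complex.norm_real, Real.norm_of_nonneg hr.le]
  exact mul_le_mul_of_nonneg_left key (inv_nonneg.mpr hr.le)

/-- the constant of the tower rate at coupling `t`: `C(t) = (C₁ + ‖t‖C₂)ν² + (C₀ + 2C_f)ν`, `ν = (1 − ‖t‖κ)⁻¹`. [folklore] -/
def Cpert (κ C₀ C₁ C₂ Cf : ℝ) (t : ℂ) : ℝ :=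
  (C₁ + ‖t‖ * C₂) * ((1 - ‖t‖ * κ)⁻¹) ^ 2 + (C₀ + 2 * Cf) * (1 - ‖t‖ * κ)⁻¹

/-- geometric defects give a geometric perturbed error: `Epert ≤ Cpert·ρ^k`. [folklore] -/
theorem Epert_le_Cpert {ρ C₀ C₁ C₂ Cf : ℝ} {t : ℂ} (ht : ‖t‖ * κ < 1) (h₀ : ∀ k, e₀ k ≤ C₀ * ρ ^ k)
    (h₁ : ∀ k, e₁ k ≤ C₁ * ρ ^ k) (h₂ : ∀ k, e₂ k ≤ C₂ * ρ ^ k) (hf : ∀ k, f k ≤ Cf * ρ ^ k) (k : ℕ) :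
    Epert κ e₀ e₁ e₂ f t k ≤ Cpert κ C₀ C₁ C₂ Cf t * ρ ^ k := by
  have hν : 0 ≤ (1 - ‖t‖ * κ)⁻¹ := inv_nonneg.mpr (sub_nonneg.mpr ht.le)
  have ha : e₁ k + ‖t‖ * e₂ k ≤ (C₁ + ‖t‖ * C₂) * ρ ^ k := by
    have := mul_le_mul_of_nonneg_left (h₂ k) (norm_nonneg t)
    nlinarith [h₁ k]
  have hb : e₀ k + 2 * f k ≤ (C₀ + 2 * Cf) * ρ ^ k := by nlinarith [h₀ k, hf k]
  unfold Epert Cpert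
  have h1 := mul_le_mul_of_nonneg_right ha (pow_nonneg hν 2)
  have h2 := mul_le_mul_of_nonneg_right hb hν
  nlinarith [h1, h2]

/-- **THE TOWER LIMIT WITH RATE FOR THE PERTURBED PROPAGATORS**: geometric free defects `e₀, e₁, f ≤ C·ρ^k`, a geometric
consistency defect `e₂ ≤ C₂ρ^k`, `ρ < 1`, `r > 0`, `‖t‖κ < 1` ⟹ `TowerLimitRate A r (k ↦ (D_k + tP_k)⁻¹) (Cpert … t) ρ`:
the unit-lattice images `r^k·A^{(k)}(D_k + tP_k)⁻¹A^{(k)ᴴ}` CONVERGE with `‖c_k(t) − c_∞(t)‖ ≤ Cpert(t)·ρ^k/(1 − ρ)`.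
[folklore] -/
theorem towerLimitRate_perturbed (hr : 0 < r) (hfree : FreeTowerLaws D A J F r e₀ e₁ f)
    (hpert : PerturbationLaws D P J κ e₂) {ρ C₀ C₁ C₂ Cf : ℝ} (hρ1 : ρ < 1)
    (h₀ : ∀ k, e₀ k ≤ C₀ * ρ ^ k) (h₁ : ∀ k, e₁ k ≤ C₁ * ρ ^ k) (h₂ : ∀ k, e₂ k ≤ C₂ * ρ ^ k)
    (hf : ∀ k, f k ≤ Cf * ρ ^ k) {t : ℂ} (ht : ‖t‖ * κ < 1) :
    TowerLimitRate A r (fun k => (D k + t • P k)⁻¹) (Cpert κ C₀ C₁ C₂ Cf t) ρ := by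
  have hlaw : OneStepAveragedLaw A r (fun k => (D k + t • P k)⁻¹) (fun k => Cpert κ C₀ C₁ C₂ Cf t * ρ ^ k) := by
    intro k
    refine (oneStepAveragedLaw_perturbed hr hfree hpert ht k).trans ?_
    exact mul_le_mul_of_nonneg_left (Epert_le_Cpert ht h₀ h₁ h₂ hf k) (inv_nonneg.mpr hr.le)
  exact towerLimitRate_of_oneStepAveragedLaw A hr hfree.opNorm_A_sq_le _ hρ1 hlaw

end Tower

/-! ## §3 Lipschitz continuity in the coupling, along the tower and in the limit (NE2-LIP, operator norm) -/

section Lipschitz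

variable {D P : (k : ℕ) → Matrix (ι k) (ι k) ℂ} {A : (k : ℕ) → Matrix (ι k) (ι (k + 1)) ℂ} {r κ γ : ℝ}

/-- sandwiching by the composite averagings does not increase norms: `‖avgTow X k − avgTow Y k‖ ≤ ‖X_k − Y_k‖`. [folklore] -/
theorem opNorm_avgTow_sub_avgTow_le (hr : 0 < r) (hA : ∀ k, ‖A k‖ ^ 2 ≤ r⁻¹) (X Y : (k : ℕ) → Matrix (ι k) (ι k) ℂ)
    (k : ℕ) : ‖avgTow A r X k - avgTow A r Y k‖ ≤ ‖X k - Y k‖ := by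
  have hrk : 0 < r ^ k := pow_pos hr k
  have e : avgTow A r X k - avgTow A r Y k = ((r : ℂ) ^ k) • (Atow A k * (X k - Y k) * (Atow A k)ᴴ) := by
    simp only [avgTow, Matrix.mul_sub, Matrix.sub_mul, smul_sub]
  rw [e, norm_smul, norm_pow, Complex.norm_real, Real.norm_of_nonneg hr.le]
  have hQ := opNorm_Atow_sq_le A hr hA k
  calc r ^ k * ‖Atow A k * (X k - Y k) * (Atow A k)ᴴ‖ ≤ r ^ k * (‖Atow A k‖ * ‖X k - Y k‖ * ‖Atow A k‖) := by
        refine mul_le_mul_of_nonneg_left ?_ hrk.le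
        calc _ ≤ ‖Atow A k * (X k - Y k)‖ * ‖(Atow A k)ᴴ‖ := Matrix.l2_opNorm_mul _ _
          _ ≤ ‖Atow A k‖ * ‖X k - Y k‖ * ‖Atow A k‖ := by
              rw [Matrix.l2_opNorm_conjTranspose]
              exact mul_le_mul_of_nonneg_right (Matrix.l2_opNorm_mul _ _) (norm_nonneg _)
    _ = r ^ k * ‖Atow A k‖ ^ 2 * ‖X k - Y k‖ := by ring
    _ ≤ r ^ k * (r ^ k)⁻¹ * ‖X k - Y k‖ := by gcongr
    _ = ‖X k - Y k‖ := by rw [mul_inv_cancel₀ hrk.ne', one_mul]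

/-- **LIPSCHITZ IN THE COUPLING ALONG THE TOWER**: with (H-bd) and free propagators bounded by `γ⁻¹`, the perturbed and free
unit-lattice images differ by at most `‖t‖κγ⁻¹(1 − ‖t‖κ)⁻¹` at EVERY level. [folklore] -/
theorem opNorm_avgTow_perturbed_sub_le (hr : 0 < r) (hA : ∀ k, ‖A k‖ ^ 2 ≤ r⁻¹) (hD : ∀ k, IsUnit (D k).det)
    (hγ : ∀ k, ‖(D k)⁻¹‖ ≤ γ⁻¹) (hPr : ∀ k, ‖P k * (D k)⁻¹‖ ≤ κ) (hPl : ∀ k, ‖(D k)⁻¹ * P k‖ ≤ κ) {t : ℂ}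
    (ht : ‖t‖ * κ < 1) (k : ℕ) :
    ‖avgTow A r (fun k => (D k + t • P k)⁻¹) k - avgTow A r (fun k => (D k)⁻¹) k‖
      ≤ ‖t‖ * κ * γ⁻¹ * (1 - ‖t‖ * κ)⁻¹ := by
  refine (opNorm_avgTow_sub_avgTow_le hr hA _ _ k).trans ?_
  refine (opNorm_inv_add_smul_sub_inv_le (hD k) (hPr k) (hPl k) ht).trans ?_
  have hν : 0 ≤ (1 - ‖t‖ * κ)⁻¹ := inv_nonneg.mpr (sub_nonneg.mpr ht.le)
  have hκ : 0 ≤ κ := (norm_nonneg _).trans (hPr k)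
  have h1 : 0 ≤ ‖t‖ * κ := mul_nonneg (norm_nonneg t) hκ
  exact mul_le_mul_of_nonneg_right (mul_le_mul_of_nonneg_left (hγ k) h1) hν

/-- **… AND IN THE LIMIT**: if both towers converge, their limits differ by at most the same amount — background-Lipschitz
continuity of the `η → 0` limit of the unit-lattice covariance (operator norm; statement ours). [folklore] -/
theorem opNorm_limit_perturbed_sub_le (hr : 0 < r) (hA : ∀ k, ‖A k‖ ^ 2 ≤ r⁻¹) (hD : ∀ k, IsUnit (D k).det)
    (hγ : ∀ k, ‖(D k)⁻¹‖ ≤ γ⁻¹) (hPr : ∀ k, ‖P k * (D k)⁻¹‖ ≤ κ) (hPl : ∀ k, ‖(D k)⁻¹ * P k‖ ≤ κ) {t : ℂ}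
    (ht : ‖t‖ * κ < 1) {ct c0 : Matrix (ι 0) (ι 0) ℂ}
    (hct : Tendsto (avgTow A r (fun k => (D k + t • P k)⁻¹)) atTop (𝓝 ct))
    (hc0 : Tendsto (avgTow A r (fun k => (D k)⁻¹)) atTop (𝓝 c0)) :
    ‖ct - c0‖ ≤ ‖t‖ * κ * γ⁻¹ * (1 - ‖t‖ * κ)⁻¹ := by
  have hlim : Tendsto (fun k => avgTow A r (fun k => (D k + t • P k)⁻¹) k - avgTow A r (fun k => (D k)⁻¹) k) atTop
      (𝓝 (ct - c0)) := hct.sub hc0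
  have hn : Tendsto (fun k => ‖avgTow A r (fun k => (D k + t • P k)⁻¹) k - avgTow A r (fun k => (D k)⁻¹) k‖) atTop
      (𝓝 ‖ct - c0‖) := (continuous_norm.tendsto _).comp hlim
  exact le_of_tendsto' hn fun k => opNorm_avgTow_perturbed_sub_le hr hA hD hγ hPr hPl ht k

end Lipschitz

end Summit.QuantumFields.BalabanUV.T4Continuum.BackgroundResolventTower

end
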